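import Mathlib
import HarnessLib.Audit
import Summits.PneNP.PneNP.Theorems.PstarFreeFoldedForms
import Summits.PneNP.PneNP.Theorems.PstarFreeFoldedFibre

/-!
# Free folded outputs are `O(Δ²)`: the two-forms bound run fibrewise over the core (ROUND-24, GAPTWO-PLAN S3 with a core)

FRONTIER range-avoidance ladder, rung F-N3, ROUND 24 (cell `pnp-ideate`, planner memo `r24/GAPTWO-PLAN.md` v0 §1/§3/§4; restricted-model
proof complexity — nothing here bears on `P` versus `NP`).

Terminal form of the `|W| = 2` analysis (memo §1): a CORE `J₀` of outputs and two G-constraints `Γ_i = (C_i, G_i, b_i)`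
(`gval I C_i G_i z = b_i`) whose monomial sets `G₁ ∪ G₂` are the FOLDED outputs, with
* (T3) `J₀ ∧ Γ₁ ∧ Γ₂` unsolvable, and
* (M′) for every folded `g`: some solution `z` of the core has `Γ_i(z) = b_i ↔ g ∉ G_i` (`i = 1, 2`) — the per-folded-output flip property
  exported by the terminal form (`PstarGapTwoTerminal`, prover-1), the analogue of edge-minimality.

Call a folded output FREE when both its AND variables are read by no output of the core.  **`card_free_le`: on a pure instance with
simple overlaps and maximum degree `Δ`, at most `6Δ²` folded outputs are free.**  (The reader cluster `K_{Δ,Δ}` — empty core, `Δ²` free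
readers — shows the order is right; with `J₀ = ∅` every folded output is free and this is T24.19 again, by a different bookkeeping.)
Consequently `|J| ≤ |J₀| + #{folded outputs meeting an AND variable of the core} + 6Δ² ≤ |J₀| + Δ·#(AND variables of J₀) + 6Δ²`: the
two-query rung `PstarGapTwo.GapTwo` reduces to a bound on the CORE alone (memo S4).

Proof (`PstarFreeFoldedForms.two_forms_fibres` + the transport of `PstarFreeFoldedFibre`).  Let `U` be the AND variables of the free folded outputs; index the
vertices by `Fin (|U|+1)` (`vx`, one junk vertex) and, for a core solution `ζ` and `x : 𝔽₂^{|U|+1}`, let `ext ζ x` overwrite `ζ` on `U` by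
`x` (`bit_ext`).  Core outputs do not read `U`, so `ext ζ x` solves the core and `(Γ₁, Γ₂)` is never `(b₁, b₂)` there (`hunsat`); in `𝔽₂`,
`bit (gval I C_i G_i (ext ζ x)) = qform T_i x + L_i ζ x + c_i ζ` (`bit_gval_ext`, `sum_coordU_mul`) with `T_i` the edges of the free
outputs of `G_i` (`TU`), a simple graph of maximum degree `Δ` (`simple_TU`, `edgeMaxDegree_TU`); the (M′)-witness of a free `g`
is a flip witness on the fibre of its own core solution (`restr`, `ext_restr`).
-/

set_option linter.dupNamespace false -- `Summit.PneNP.PneNP.…`: summit = sub-problem name (D-0017 single-conjunct layout)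

open Finset Module Literature.Computability.Complexity
open Summit.PneNP.PneNP.Theorems.PstarSALevel (varSet SimpleOverlap)
open Summit.PneNP.PneNP.Theorems.PstarGapLemma (MaxDegree)
open Summit.PneNP.PneNP.Theorems.PstarGapLinearised (andPair andPair_subset_varSet)
open Summit.PneNP.PneNP.Theorems.PstarGapPeeling (eval_congr)
open Summit.PneNP.PneNP.Theorems.PstarFibrePolys (bit bit_injective bit_add_bit_eq_zero_iff)
open Summit.PneNP.PneNP.Theorems.PstarProductRank (qform)
open Summit.PneNP.PneNP.Theorems.PstarGraphQuadGap (Edge Simple EdgeMaxDegree)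
open Summit.PneNP.PneNP.Theorems.PstarGapOneAll (gval)
open Summit.PneNP.PneNP.Theorems.PstarGConstraint (bit_gval andPairs_simple)
open Summit.PneNP.PneNP.Theorems.PstarFreeFoldedForms (two_forms_fibres)
open Summit.PneNP.PneNP.Theorems.PstarFreeFoldedFibre

namespace Summit.PneNP.PneNP.Theorems.PstarFreeFolded

variable {n m : ℕ}


/-! ## The bound -/

section Bound

variable (I : LocalMap 4 n m) (hI : I.IsPure xorAndPred) (hS : SimpleOverlap I) {Δ : ℕ} (hD : MaxDegree Δ I)
  (y : Fin m → Bool) (J₀ : Finset (Fin m)) (C₁ C₂ : Finset (Fin n)) (G₁ G₂ : Finset (Fin m)) (b₁ b₂ : Bool)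

/-- A folded output is FREE (relative to the core `J₀`) when both its AND variables are read by no output of `J₀`. -/
def Free (g : Fin m) : Prop := ∀ j ∈ J₀, I.vars g 2 ∉ varSet I j ∧ I.vars g 3 ∉ varSet I j

include hI hS hD in
/-- **At most `6Δ²` folded outputs are free.**  Hypotheses: the core together with the two G-constraints is unsolvable, and every
free folded output has its flip witness among the solutions of the core ((M′) of the terminal form). -/
theorem card_free_le [DecidablePred (Free I J₀)]
    (hinf : ¬ ∃ z : Fin n → Bool, (∀ j ∈ J₀, I.eval z j = y j) ∧ gval I C₁ G₁ z = b₁ ∧ gval I C₂ G₂ z = b₂)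
    (hM : ∀ g ∈ G₁ ∪ G₂, Free I J₀ g → ∃ z : Fin n → Bool, (∀ j ∈ J₀, I.eval z j = y j) ∧
      (gval I C₁ G₁ z = b₁ ↔ g ∉ G₁) ∧ (gval I C₂ G₂ z = b₂ ↔ g ∉ G₂)) :
    ((G₁ ∪ G₂).filter (Free I J₀)).card ≤ 6 * Δ ^ 2 := by
  classical
  -- the free variables
  set U : Finset (Fin n) := ((G₁ ∪ G₂).filter (Free I J₀)).biUnion (andPair I) with hUdef
  have hUread : ∀ v ∈ U, ∀ j ∈ J₀, v ∉ varSet I j := by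
    intro v hv j hj
    rw [hUdef, mem_biUnion] at hv
    obtain ⟨g, hg, hvg⟩ := hv
    have hfree := (mem_filter.1 hg).2 j hj
    unfold PstarGapLinearised.andPair at hvg
    rw [mem_insert, mem_singleton] at hvg
    rcases hvg with rfl | rfl
    exacts [hfree.1, hfree.2]
  -- `J₀`-free ⟹ `U`-free on `G₁ ∪ G₂`, and `U`-free ⟹ `J₀`-free everywhere
  have hFU : ∀ g ∈ G₁ ∪ G₂, Free I J₀ g → FreeU U I g := fun g hg hf =>
    ⟨mem_biUnion.2 ⟨g, mem_filter.2 ⟨hg, hf⟩, by simp [PstarGapLinearised.andPair]⟩,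
      mem_biUnion.2 ⟨g, mem_filter.2 ⟨hg, hf⟩, by simp [PstarGapLinearised.andPair]⟩⟩
  have hUF : ∀ g, FreeU U I g → Free I J₀ g := fun g hg j hj => ⟨hUread _ hg.1 j hj, hUread _ hg.2 j hj⟩
  -- count the `J₀`-free outputs by `U`-free edges
  have hle : ((G₁ ∪ G₂).filter (Free I J₀)).card ≤ ((G₁ ∪ G₂).filter (FreeU U I)).card :=
    card_le_card fun g hg => mem_filter.2 ⟨(mem_filter.1 hg).1, hFU g (mem_filter.1 hg).1 (mem_filter.1 hg).2⟩
  refine hle.trans ?_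
  rw [card_filter_free_eq U I hI hS, show TU U I (G₁ ∪ G₂) = TU U I G₁ ∪ TU U I G₂ by
    unfold TU; rw [filter_union, image_union]]
  -- the fibre family
  let Z := {z : Fin n → Bool // ∀ j ∈ J₀, I.eval z j = y j}
  let f₁ : Z → (Fin (U.card + 1) → ZMod 2) → ZMod 2 := fun ζ x => bit (gval I C₁ G₁ (ext U ζ.1 x)) + bit b₁
  let f₂ : Z → (Fin (U.card + 1) → ZMod 2) → ZMod 2 := fun ζ x => bit (gval I C₂ G₂ (ext U ζ.1 x)) + bit b₂
  have hsol : ∀ (ζ : Z) (x : Fin (U.card + 1) → ZMod 2), ∀ j ∈ J₀, I.eval (ext U ζ.1 x) j = y j :=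
    fun ζ x j hj => by rw [eval_ext U I ζ.1 x fun v hv => hUread v hv j hj]; exact ζ.2 j hj
  have hf₁0 : ∀ (ζ : Z) x, f₁ ζ x = 0 ↔ gval I C₁ G₁ (ext U ζ.1 x) = b₁ := fun ζ x => bit_add_bit_eq_zero_iff _ _
  have hf₂0 : ∀ (ζ : Z) x, f₂ ζ x = 0 ↔ gval I C₂ G₂ (ext U ζ.1 x) = b₂ := fun ζ x => bit_add_bit_eq_zero_iff _ _
  have hTU : TU U I G₁ ∪ TU U I G₂ = TU U I (G₁ ∪ G₂) := by unfold TU; rw [filter_union, image_union]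
  refine two_forms_fibres (E := TU U I G₁ ∪ TU U I G₂) (T₁ := TU U I G₁) (T₂ := TU U I G₂) (f₁ := f₁) (f₂ := f₂)
    (L₁ := fun ζ => linG U I ζ.1 C₁ G₁) (L₂ := fun ζ => linG U I ζ.1 C₂ G₂)
    (c₁ := fun ζ => constG U I ζ.1 C₁ G₁ + bit b₁) (c₂ := fun ζ => constG U I ζ.1 C₂ G₂ + bit b₂)
    (by rw [hTU]; exact simple_TU U I hI _) (by rw [hTU]; exact edgeMaxDegree_TU U I hD _)
    subset_union_left subset_union_right ?_ ?_ ?_ ?_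
  · intro ζ x
    show bit (gval I C₁ G₁ (ext U ζ.1 x)) + bit b₁ = _
    rw [bit_gval_ext, sum_coordU_mul U I hI hS]; ring
  · intro ζ x
    show bit (gval I C₂ G₂ (ext U ζ.1 x)) + bit b₂ = _
    rw [bit_gval_ext, sum_coordU_mul U I hI hS]; ring
  · -- unsat on every fibre
    intro ζ x
    by_contra h
    push Not at h
    exact hinf ⟨ext U ζ.1 x, hsol ζ x, (hf₁0 ζ x).1 h.1, (hf₂0 ζ x).1 h.2⟩
  · -- witnesses: the (M′)-point of a free output, on its own fibre
    intro t ht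
    have ht' : t ∈ TU U I (G₁ ∪ G₂) := by rw [← hTU]; exact ht
    unfold TU at ht'
    obtain ⟨g, hg, rfl⟩ := mem_image.1 ht'
    obtain ⟨hgG, hfree⟩ := mem_filter.1 hg
    obtain ⟨z, hzJ, hz1, hz2⟩ := hM g hgG (hUF g hfree)
    refine ⟨⟨z, hzJ⟩, restr U z, ?_, ?_⟩
    · rw [hf₁0, edgeU_mem_TU_iff U I hI hS hfree]
      show gval I C₁ G₁ (ext U z (restr U z)) = b₁ ↔ g ∉ G₁
      rw [ext_restr]; exact hz1
    · rw [hf₂0, edgeU_mem_TU_iff U I hI hS hfree]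
      show gval I C₂ G₂ (ext U z (restr U z)) = b₂ ↔ g ∉ G₂
      rw [ext_restr]; exact hz2

include hD in
/-- A folded output that is NOT free reads a variable of the core's neighbourhood, so there are at most `Δ · #nbhd(J₀) ≤ 4Δ·|J₀|`
of them. -/
theorem card_not_free_le [DecidablePred (Free I J₀)] (G : Finset (Fin m)) :
    (G.filter fun g => ¬ Free I J₀ g).card ≤ Δ * (4 * J₀.card) := by
  classical
  set N : Finset (Fin n) := J₀.biUnion (varSet I) with hN
  have hsub : (G.filter fun g => ¬ Free I J₀ g) ⊆ N.biUnion fun v => (univ : Finset (Fin m)).filter fun g => v ∈ varSet I g := by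
    intro g hg
    obtain ⟨-, hnf⟩ := mem_filter.1 hg
    unfold Free at hnf
    push Not at hnf
    obtain ⟨j, hj, hv⟩ := hnf
    rw [mem_biUnion]
    by_cases h2 : I.vars g 2 ∈ varSet I j
    · exact ⟨I.vars g 2, mem_biUnion.2 ⟨j, hj, h2⟩, mem_filter.2 ⟨mem_univ _, mem_image.2 ⟨2, mem_univ _, rfl⟩⟩⟩
    · exact ⟨I.vars g 3, mem_biUnion.2 ⟨j, hj, hv h2⟩, mem_filter.2 ⟨mem_univ _, mem_image.2 ⟨3, mem_univ _, rfl⟩⟩⟩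
  have hNcard : N.card ≤ 4 * J₀.card := by
    rw [hN]
    refine card_biUnion_le.trans ?_
    calc ∑ j ∈ J₀, (varSet I j).card ≤ ∑ _j ∈ J₀, 4 := sum_le_sum fun j _ => by
            unfold PstarSALevel.varSet; exact card_image_le.trans (by simp)
      _ = 4 * J₀.card := by rw [sum_const, smul_eq_mul, mul_comm]
  calc (G.filter fun g => ¬ Free I J₀ g).card ≤ (N.biUnion fun v => (univ : Finset (Fin m)).filter fun g => v ∈ varSet I g).card :=
        card_le_card hsub
    _ ≤ ∑ v ∈ N, ((univ : Finset (Fin m)).filter fun g => v ∈ varSet I g).card := card_biUnion_le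
    _ ≤ ∑ _v ∈ N, Δ := sum_le_sum fun v _ => hD v
    _ = Δ * N.card := by rw [sum_const, smul_eq_mul, mul_comm]
    _ ≤ Δ * (4 * J₀.card) := Nat.mul_le_mul_left Δ hNcard

include hI hS hD in
/-- **The folded outputs are bounded by the core**: `#(G₁ ∪ G₂) ≤ 6Δ² + 4Δ·|J₀|`.  Hence in the terminal form `|J| ≤ (4Δ+1)|J₀| + 6Δ²` and
the two-query rung reduces to a bound on the core (GAPTWO-PLAN S4). -/
theorem card_folded_le
    (hinf : ¬ ∃ z : Fin n → Bool, (∀ j ∈ J₀, I.eval z j = y j) ∧ gval I C₁ G₁ z = b₁ ∧ gval I C₂ G₂ z = b₂)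
    (hM : ∀ g ∈ G₁ ∪ G₂, Free I J₀ g → ∃ z : Fin n → Bool, (∀ j ∈ J₀, I.eval z j = y j) ∧
      (gval I C₁ G₁ z = b₁ ↔ g ∉ G₁) ∧ (gval I C₂ G₂ z = b₂ ↔ g ∉ G₂)) :
    (G₁ ∪ G₂).card ≤ 6 * Δ ^ 2 + Δ * (4 * J₀.card) := by
  classical
  rw [← Finset.card_filter_add_card_filter_not (Free I J₀)]
  exact Nat.add_le_add (card_free_le I hI hS hD y J₀ C₁ C₂ G₁ G₂ b₁ b₂ hinf hM) (card_not_free_le I hD J₀ _)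

include hI hS hD in
/-- **System form** (matching the output of the terminal form, `PstarGapTwoTerminal`): a G-system `𝒲` of at most two constraints that is
unsolvable together with the core and whose free monomial outputs have flip witnesses among the core solutions has at most
`6Δ² + 4Δ·|J₀|` monomial outputs. -/
theorem card_monomials_le_of_core [DecidablePred (Free I J₀)] (𝒲 : Finset (Finset (Fin n) × Finset (Fin m) × Bool))
    (h𝒲 : 𝒲.card ≤ 2)
    (hinf : ¬ ∃ z : Fin n → Bool, (∀ j ∈ J₀, I.eval z j = y j) ∧ ∀ w ∈ 𝒲, gval I w.1 w.2.1 z = w.2.2)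
    (hM : ∀ w₀ ∈ 𝒲, ∀ g ∈ w₀.2.1, Free I J₀ g → ∃ z : Fin n → Bool, (∀ j ∈ J₀, I.eval z j = y j) ∧
      ∀ w ∈ 𝒲, (gval I w.1 w.2.1 z = w.2.2 ↔ g ∉ w.2.1)) :
    (𝒲.biUnion fun w => w.2.1).card ≤ 6 * Δ ^ 2 + Δ * (4 * J₀.card) := by
  classical
  have hc : 𝒲.card = 0 ∨ 𝒲.card = 1 ∨ 𝒲.card = 2 := by omega
  rcases hc with h0 | h1 | h2
  · rw [card_eq_zero.1 h0, biUnion_empty, card_empty]; exact Nat.zero_le _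
  · obtain ⟨w, rfl⟩ := card_eq_one.1 h1
    rw [singleton_biUnion]
    have key := card_folded_le I hI hS hD y J₀ w.1 w.1 w.2.1 w.2.1 w.2.2 w.2.2
      (fun ⟨z, hzJ, hz1, _⟩ => hinf ⟨z, hzJ, fun w' hw' => by rw [mem_singleton.1 hw']; exact hz1⟩)
      (fun g hg hfree => by
        rw [union_idempotent] at hg
        obtain ⟨z, hzJ, hz⟩ := hM w (mem_singleton_self w) g hg hfree
        exact ⟨z, hzJ, hz w (mem_singleton_self w), hz w (mem_singleton_self w)⟩)
    rwa [union_idempotent] at key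
  · obtain ⟨w₁, w₂, hne, rfl⟩ := card_eq_two.1 h2
    rw [biUnion_insert, singleton_biUnion]
    refine card_folded_le I hI hS hD y J₀ w₁.1 w₂.1 w₁.2.1 w₂.2.1 w₁.2.2 w₂.2.2
      (fun ⟨z, hzJ, hz1, hz2⟩ => hinf ⟨z, hzJ, fun w' hw' => ?_⟩) (fun g hg hfree => ?_)
    · rw [mem_insert, mem_singleton] at hw'
      rcases hw' with rfl | rfl
      exacts [hz1, hz2]
    · have hw₁ : w₁ ∈ ({w₁, w₂} : Finset _) := mem_insert_self _ _
      have hw₂ : w₂ ∈ ({w₁, w₂} : Finset _) := mem_insert_of_mem (mem_singleton_self _)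
      rcases mem_union.1 hg with h | h
      · obtain ⟨z, hzJ, hz⟩ := hM w₁ hw₁ g h hfree
        exact ⟨z, hzJ, hz w₁ hw₁, hz w₂ hw₂⟩
      · obtain ⟨z, hzJ, hz⟩ := hM w₂ hw₂ g h hfree
        exact ⟨z, hzJ, hz w₁ hw₁, hz w₂ hw₂⟩

end Bound

end Summit.PneNP.PneNP.Theorems.PstarFreeFolded
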